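import Summits.NavierStokesRegularity.FluidComputer.GeometricFace
import Summits.NavierStokesRegularity.FluidComputer.LerayClock
import Summits.NavierStokesRegularity.NavierStokesRegularity.Theorems.FluidComputerCascade
import Literature.Analysis.FluidPDE.VorticitySupEnstrophyGronwall
import Literature.Analysis.FluidPDE.BKMClassEnstrophyContinuity
import Literature.Analysis.FluidPDE.TaoEnstrophyLocalisationProofs
import HarnessLib

/-!
# Fluid computer — L65: THE VORTICITY TYPE-I THRESHOLD, CONSTANT ONE QUARTER:
# `limsup_{t↑T} (T − t)·‖ω(t)‖_∞ ≥ 1/4` at every Navier–Stokes blow-up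

HONEST FRAMING (cell `pub-fluidc`, verbatim): *low prior, high value-of-information experiment on Tao's
machine paradigm; NOT a claim that NS blows up.* Theorem side of the cell (the level dictionary); nothing here is
evidence of blow-up — necessities for EVERY maximal smooth finite-energy solution on `ℝ³`.

L31 / E1 are the Beale–Kato–Majda rows: `∫_{t₀}^T ‖ω(t)‖_∞ dt = ∞` on every terminal window — no constant, and no
rate: `‖ω(t)‖_∞ = ε/(T − t)` is compatible with them for EVERY `ε > 0`. The viscous class has a rate nonetheless. The
tree holds Robinson–Rodrigo–Sadowski's form of the BKM a priori estimate (Thm 12.3, (12.11)–(12.12)):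
`d/dt ‖ω‖₂² ≤ 2‖ω‖_∞‖ω‖₂²`, typed on closed slabs of the Beale–Kato–Majda class as
`∫|ω(t)|² ≤ ∫|ω(0)|² · exp(2Ω T'')` under `|ω| ≤ Ω` (`integral_sq_norm_curl_le_mul_exp_of_norm_curl_le`), and Leray's
`H¹` rate `c ν³ ≤ (∫|∇u(t)|²)²·(T − t)` at EVERY `t` (L19, `LerayClock.enstrophy_clock`). If `(T − t)‖ω(t)‖_∞ ≤ ε` on a
terminal window, chaining the slab estimate along the geometric times `t_k = T − L r^{−k}` gives
`∫|ω(t_k)|² ≤ ∫|ω(t_0)|² · e^{2ε(r−1)k}`, while Leray forces `∫|ω(t_k)|² ≳ ν^{3/2} L^{−1/2} r^{k/2}`: impossible as soon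
as `4ε(r − 1) < log r`, i.e. — letting `r ↓ 1` — as soon as `ε < 1/4`. Along every maximal smooth solution `(u, p)` of the
unforced Navier–Stokes system on `ℝ³ × [0, T)` (`ν > 0`) which is Leray–Hopf from `u 0`:

* `enstrophy_slab_step` — the slab estimate ON THE CLASS: `∫|ω(b)|² ≤ ∫|ω(s)|²·exp(2Ω(b − s))` whenever `|ω| ≤ Ω` on
  `[s, b] × ℝ³`, `0 < s < b < T` (translate at `s`; the class hypothesis is discharged by gen 15's
  `GeometricFace.hasBoundedSobolevNormsOn_translate`);
* `leray_curl_clock` — L19 in vorticity currency: `c ν³ ≤ (∫|ω(t)|²)²·(T − t)` at every `t ∈ (0, T)`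
  (`∫|∇u|²_F ≤ ∫|ω|²`, `lintegral_frobeniusNormSq_fderiv_le_lintegral_sq_norm_curl`);
* `ns_vorticity_typeI_threshold` (**L65 — THE VORTICITY TYPE-I THRESHOLD, CONSTANT `1/4`**): for every `ε < 1/4` and
  every `a ∈ [0, T)` there are `t ∈ [a, T)` and `x` with `ε < (T − t)·‖ω(t, x)‖` —
  `limsup_{t↑T} (T − t)‖ω(t)‖_∞ ≥ 1/4`;
* `ns_vorticity_typeI_frequently` — filter form; `ns_vorticity_typeI_threshold_of_cascadeWitness` — interface reading.

Placement: L63 (`(T − t)‖∇u‖_∞ ≥ 1` i.o.) and L64 (`(T − t) sup λ₂ ≥ 1/4` i.o.) do not imply L65 — `|ω|`, `|∇u|`, `λ₂`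
are pointwise independent up to `|ω| ≤ 2|∇u|`; L65 is the VORTICITY member of the family of weak Type-I thresholds with
an EXPLICIT constant: a design whose `(T − t)·max|ω|` settles below `1/4` is not approaching a singularity at that `T`.
HONEST PLACEMENT: a corollary of Robinson–Rodrigo–Sadowski 2016 (12.12) and Leray's rate (their Lemma 6.11 / Cor. 6.19),
both typed in the tree; not located in print as a stated Type-I threshold; the constant `1/4` comes from the pointwise
bound `2⟪ω, ∇u ω⟫ ≤ ‖ω‖_∞(|∇u|² + |ω|²)` and is NOT claimed optimal (Cauchy–Schwarz with `‖S‖₂ = ‖ω‖₂/√2` would give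
`√2/4`); weak (limsup) form only; `ν > 0` is used (no Euler analogue by this route). Necessity only. 0 sorry; no
definitions; no named facts.

## References

* J. C. Robinson, J. L. Rodrigo, W. Sadowski, *The Three-Dimensional Navier–Stokes Equations*, CUP 2016, Thm 12.3
  with (12.11)–(12.12); Lemma 6.11. [RobinsonRodrigoSadowski2016]
* J. Leray, Acta Math. 63 (1934) 193–248, §20. [Leray1934]
* J. T. Beale, T. Kato, A. Majda, Comm. Math. Phys. 94 (1984) 61–66, Thm. 1. [BealeKatoMajda1984]
-/

noncomputable section

open MeasureTheory Set Function Filter Topology Metric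
open scoped ENNReal NNReal RealInnerProductSpace
open Literature.Analysis.FluidPDE Literature.Analysis.FunctionSpaces
open Literature.Analysis.FluidPDE.FluidComputer
open Summit.NavierStokesRegularity.NavierStokesRegularity.Theorems.FluidComputer (x5a_of_cascadeWitness')

namespace Summit.NavierStokesRegularity.FluidComputer.VorticityTypeIFace

/-! ## The slab estimate and Leray's rate, in vorticity currency, on the class -/

/-- **RRS (12.12) on an interior slab of a maximal smooth Leray–Hopf solution**: for `0 < s < b < T` and
`‖ω(t, x)‖ ≤ Ω` on `[s, b] × ℝ³`, `∫|ω(b)|² ≤ (∫|ω(s)|²)·exp(2Ω(b − s))` (`ω = curl u`; the translate `u(· + s)` is a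
classical solution on `[0, b − s]` in the Beale–Kato–Majda class, `GeometricFace.hasBoundedSobolevNormsOn_translate`, and
`integral_sq_norm_curl_le_mul_exp_of_norm_curl_le` applies). [cite: RobinsonRodrigoSadowski2016, Thm 12.3 (12.12)] -/
theorem enstrophy_slab_step {ν T : ℝ} (hν : 0 < ν) (hT : 0 < T)
    {u : ℝ → EuclideanSpace ℝ (Fin 3) → EuclideanSpace ℝ (Fin 3)} {p : ℝ → EuclideanSpace ℝ (Fin 3) → ℝ}
    (hmax : IsMaximalSmoothSolution ν 0 u p T) (hLH : IsLerayHopfOn T ν 0 (u 0) u)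
    {s b : ℝ} (hs : 0 < s) (hsb : s < b) (hbT : b < T)
    {Ω : ℝ} (hΩ : ∀ t ∈ Icc s b, ∀ x, ‖curl (u t) x‖ ≤ Ω) :
    ∫ x, ‖curl (u b) x‖ ^ 2 ≤ (∫ x, ‖curl (u s) x‖ ^ 2) * Real.exp (2 * Ω * (b - s)) := by
  have hbs : 0 < b - s := sub_pos.2 hsb
  set v : ℝ → EuclideanSpace ℝ (Fin 3) → EuclideanSpace ℝ (Fin 3) := fun τ => u (τ + s) with hv
  have hcl : IsClassicalNSSolutionOn (Icc 0 (b - s)) ν 0 v (fun τ => p (τ + s)) :=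
    (hmax.1.translate_Ico_zero hs.le).mono (fun τ hτ => ⟨hτ.1, by linarith [hτ.2]⟩) (uniqueDiffOn_Icc hbs)
  have hB : HasBoundedSobolevNormsOn (Icc 0 (b - s)) v :=
    GeometricFace.hasBoundedSobolevNormsOn_translate hν hT hmax hLH ⟨hs, hsb.trans hbT⟩ (by linarith)
  have hΩ' : ∀ τ ∈ Icc 0 (b - s), ∀ x, ‖curl (v τ) x‖ ≤ Ω := fun τ hτ x =>
    hΩ (τ + s) ⟨by linarith [hτ.1], by linarith [hτ.2]⟩ x
  have h := integral_sq_norm_curl_le_mul_exp_of_norm_curl_le hν hbs hcl hB hΩ' (b - s) ⟨hbs.le, le_rfl⟩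
  have e1 : v (b - s) = u b := by rw [hv]; simp only [sub_add_cancel]
  have e0 : v 0 = u s := by rw [hv]; simp only [zero_add]
  rw [e1, e0] at h
  exact h

/-- **Leray's `H¹` rate in vorticity currency (L19 through `∫|∇u|²_F ≤ ∫|ω|²`).** With the absolute constant `c` of
`LerayClock.enstrophy_clock_toReal`: along every maximal smooth Leray–Hopf solution of the unforced system (`ν > 0`), at
every `t ∈ (0, T)`, `c ν³ ≤ (∫|curl u(t)|²)²·(T − t)`. [cite: RobinsonRodrigoSadowski2016, Lemma 6.11] [cite: Leray1934, §20] -/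
theorem leray_curl_clock :
    ∃ c : ℝ, 0 < c ∧ ∀ (ν T : ℝ), 0 < ν → 0 < T →
      ∀ (u : ℝ → EuclideanSpace ℝ (Fin 3) → EuclideanSpace ℝ (Fin 3)) (p : ℝ → EuclideanSpace ℝ (Fin 3) → ℝ),
      IsMaximalSmoothSolution ν 0 u p T → IsLerayHopfOn T ν 0 (u 0) u →
      ∀ t ∈ Ioo 0 T, c * ν ^ 3 ≤ (∫ x, ‖curl (u t) x‖ ^ 2) ^ 2 * (T - t) := by
  obtain ⟨c, hc, H⟩ := LerayClock.enstrophy_clock_toReal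
  refine ⟨c, hc, fun ν T hν hT u p hmax hLH t ht => ?_⟩
  have h := H ν T hν hT u p hmax hLH t ht
  have hTt : 0 ≤ T - t := (sub_pos.2 ht.2).le
  -- the slice `u t`: smooth, divergence free, finite energy, `D¹ ∈ L²`
  have hC2 : ContDiff ℝ 2 (u t) := (hmax.1.contDiff_velocity ⟨ht.1.le, ht.2⟩).of_le (by norm_cast)
  have hdiv : VectorCalculus.IsDivFree (u t) := hmax.1.divFree t ⟨ht.1.le, ht.2⟩
  have hL2 : ∫⁻ x, ‖u t x‖ₑ ^ 2 < ⊤ := by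
    have hmem : MemLp (u t) 2 volume := hLH.memLp t ⟨ht.1.le, ht.2.le⟩
    exact Literature.Analysis.FunctionSpaces.lintegral_enorm_sq_lt_top_iff.2 hmem.eLpNorm_lt_top
  have hD1 : ∫⁻ x, ‖iteratedFDeriv ℝ 1 (u t) x‖ₑ ^ 2 < ⊤ := by
    have hSob := GeometricFace.hasBoundedSobolevNormsOn_translate hν hT hmax hLH ht (T'' := (T - t) / 2)
      (by linarith [ht.2])
    obtain ⟨C, hC⟩ := hSob 1
    have h0 := hC 0 ⟨le_rfl, by linarith [ht.2]⟩
    simp only [zero_add] at h0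
    exact h0.trans_lt ENNReal.coe_lt_top
  have hle : (∫⁻ x, ENNReal.ofReal (frobeniusNormSq (fderiv ℝ (u t) x))).toReal ≤ ∫ x, ‖curl (u t) x‖ ^ 2 := by
    have h1 := lintegral_frobeniusNormSq_fderiv_le_lintegral_sq_norm_curl hC2 hdiv hL2
    rw [lintegral_enorm_curl_sq_eq_ofReal_integral hC2 hD1] at h1
    exact ENNReal.toReal_le_of_le_ofReal (integral_nonneg fun x => sq_nonneg _) h1
  have hsq : (∫⁻ x, ENNReal.ofReal (frobeniusNormSq (fderiv ℝ (u t) x))).toReal ^ 2 ≤ (∫ x, ‖curl (u t) x‖ ^ 2) ^ 2 :=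
    pow_le_pow_left₀ ENNReal.toReal_nonneg hle 2
  exact h.trans (mul_le_mul_of_nonneg_right hsq hTt)

/-! ## L65: the vorticity Type-I threshold -/

/-- **L65 — THE VORTICITY TYPE-I THRESHOLD, CONSTANT ONE QUARTER.** For every `ν > 0`, `T > 0`, every maximal smooth
solution `(u, p)` of the unforced Navier–Stokes system on `ℝ³ × [0, T)` which is Leray–Hopf from `u 0`, every `ε < 1/4`
and every `a ∈ [0, T)`, there are `t ∈ [a, T)` and `x ∈ ℝ³` with `ε < (T − t)·‖curl u(t, x)‖` —
`limsup_{t↑T} (T − t)‖ω(t)‖_∞ ≥ 1/4`. Proof: if `(T − t)‖ω(t, x)‖ ≤ ε` on `[a, T) × ℝ³` then along the geometric times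
`t_k = T − L r^{−k}` (`t_0 = (a + T)/2`, `L = T − t_0`, `r = 1 + δ`, `δ = (1 − 4ε)/2`) the slab estimate with
`Ω_k = ε r^{k+1}/L` gives `∫|ω(t_{k+1})|² ≤ ∫|ω(t_k)|²·e^{2εδ}`, so `∫|ω(t_k)|² ≤ ∫|ω(t_0)|²·e^{2εδk}`, whereas Leray's
rate gives `cν³ r^k/L ≤ (∫|ω(t_k)|²)²`; hence `(r e^{−4εδ})^k` stays bounded — but `log r ≥ 1 − 1/r = δ/(1+δ) > 4εδ`
because `4ε(1 + δ) = 6ε − 8ε² < 1` for `ε < 1/4`, so `r e^{−4εδ} > 1`: contradiction. In words for the machine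
paradigm: the product `(T − t)·max_x|ω(t, x)|` of a run approaching a genuine singularity at `T` cannot settle below
`1/4`. Necessity only; `1/4` not claimed optimal; weak form only. [cite: RobinsonRodrigoSadowski2016, Thm 12.3 (12.12) and Lemma 6.11]
[cite: Leray1934, §20] -/
theorem ns_vorticity_typeI_threshold {ν T : ℝ} (hν : 0 < ν) (hT : 0 < T)
    {u : ℝ → EuclideanSpace ℝ (Fin 3) → EuclideanSpace ℝ (Fin 3)} {p : ℝ → EuclideanSpace ℝ (Fin 3) → ℝ}
    (hmax : IsMaximalSmoothSolution ν 0 u p T) (hLH : IsLerayHopfOn T ν 0 (u 0) u)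
    {ε : ℝ} (hε : ε < 1 / 4) {a : ℝ} (ha : a ∈ Ico 0 T) :
    ∃ t ∈ Ico a T, ∃ x : EuclideanSpace ℝ (Fin 3), ε < (T - t) * ‖curl (u t) x‖ := by
  obtain ⟨c, hc, hclock⟩ := leray_curl_clock
  by_contra hno
  push Not at hno
  -- `ε ≥ 0` (the hypothesis at `(a, 0)`)
  have hε0 : 0 ≤ ε := le_trans (mul_nonneg (sub_pos.2 ha.2).le (norm_nonneg _)) (hno a ⟨le_rfl, ha.2⟩ 0)
  -- the geometric time grid
  set t₁ : ℝ := (a + T) / 2 with ht₁def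
  have ht₁a : a < t₁ := by rw [ht₁def]; linarith [ha.2]
  have ht₁T : t₁ < T := by rw [ht₁def]; linarith [ha.2]
  have ht₁0 : 0 < t₁ := ha.1.trans_lt ht₁a
  set L : ℝ := T - t₁ with hLdef
  have hL0 : 0 < L := sub_pos.2 ht₁T
  set δ : ℝ := (1 - 4 * ε) / 2 with hδdef
  have hδ0 : 0 < δ := by rw [hδdef]; linarith
  set r : ℝ := 1 + δ with hrdef
  have hr1 : 1 < r := by rw [hrdef]; linarith
  have hr0 : 0 < r := one_pos.trans hr1
  have hrk0 : ∀ k : ℕ, 0 < r ^ k := fun k => pow_pos hr0 k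
  have hrk1 : ∀ k : ℕ, 1 ≤ r ^ k := fun k => one_le_pow₀ hr1.le
  set tk : ℕ → ℝ := fun k => T - L / r ^ k with htkdef
  have htk_sub : ∀ k, T - tk k = L / r ^ k := fun k => by rw [htkdef]; ring
  have htk_lt : ∀ k, tk k < T := fun k => by
    have : 0 < L / r ^ k := div_pos hL0 (hrk0 k)
    rw [htkdef]; simp only; linarith
  have htk_ge : ∀ k, t₁ ≤ tk k := fun k => by
    have h1 : L / r ^ k ≤ L := div_le_self hL0.le (hrk1 k)
    have : tk k = T - L / r ^ k := rfl
    rw [this, hLdef] at *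
    linarith
  have htk_pos : ∀ k, 0 < tk k := fun k => ht₁0.trans_le (htk_ge k)
  have htk_a : ∀ k, a ≤ tk k := fun k => ht₁a.le.trans (htk_ge k)
  have htk_step : ∀ k, tk (k + 1) - tk k = L * δ / r ^ (k + 1) := fun k => by
    rw [htkdef]; simp only
    rw [pow_succ]
    field_simp
    rw [hrdef]; ring
  have htk_mono : ∀ k, tk k < tk (k + 1) := fun k => by
    have : 0 < L * δ / r ^ (k + 1) := div_pos (mul_pos hL0 hδ0) (hrk0 _)
    linarith [htk_step k]
  have htk0 : tk 0 = t₁ := by rw [htkdef]; simp only [pow_zero, div_one]; rw [hLdef]; ring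
  -- the enstrophies at the grid times
  set Z : ℕ → ℝ := fun k => ∫ x, ‖curl (u (tk k)) x‖ ^ 2 with hZdef
  have hZ0 : ∀ k, 0 ≤ Z k := fun k => integral_nonneg fun x => sq_nonneg _
  set E : ℝ := Real.exp (2 * ε * δ) with hEdef
  have hE0 : 0 < E := Real.exp_pos _
  -- one step: `Z (k+1) ≤ Z k · E`
  have hstep : ∀ k, Z (k + 1) ≤ Z k * E := by
    intro k
    set Ω : ℝ := ε * r ^ (k + 1) / L with hΩdef
    have hΩ : ∀ t ∈ Icc (tk k) (tk (k + 1)), ∀ x, ‖curl (u t) x‖ ≤ Ω := by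
      intro t ht x
      have htI : t ∈ Ico a T := ⟨(htk_a k).trans ht.1, ht.2.trans_lt (htk_lt _)⟩
      have hTt : 0 < T - t := sub_pos.2 htI.2
      have h1 : ‖curl (u t) x‖ ≤ ε / (T - t) := by
        rw [le_div_iff₀ hTt, mul_comm]
        exact hno t htI x
      have h2 : ε / (T - t) ≤ ε / (T - tk (k + 1)) :=
        div_le_div_of_nonneg_left hε0 (sub_pos.2 (htk_lt _)) (by linarith [ht.2])
      have h3 : ε / (T - tk (k + 1)) = Ω := by
        rw [htk_sub, hΩdef]
        field_simp
      linarith [h3.le, h3.ge]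
    have h := enstrophy_slab_step hν hT hmax hLH (htk_pos k) (htk_mono k) (htk_lt _) hΩ
    have hexp : 2 * Ω * (tk (k + 1) - tk k) = 2 * ε * δ := by
      rw [htk_step, hΩdef]
      field_simp
    rw [hexp] at h
    exact h
  -- the chain: `Z k ≤ Z 0 · E^k`
  have hchain : ∀ k : ℕ, Z k ≤ Z 0 * E ^ k := by
    intro k
    induction k with
    | zero => simp
    | succ k ih =>
      calc Z (k + 1) ≤ Z k * E := hstep k
        _ ≤ Z 0 * E ^ k * E := mul_le_mul_of_nonneg_right ih hE0.le
        _ = Z 0 * E ^ (k + 1) := by rw [pow_succ]; ring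
  -- Leray's rate at the grid times: `c ν³ r^k / L ≤ (Z k)²`
  have hleray : ∀ k : ℕ, c * ν ^ 3 * r ^ k / L ≤ Z k ^ 2 := by
    intro k
    have h := hclock ν T hν hT u p hmax hLH (tk k) ⟨htk_pos k, htk_lt k⟩
    rw [htk_sub] at h
    rw [div_le_iff₀ hL0]
    have h' : c * ν ^ 3 * r ^ k ≤ Z k ^ 2 * (L / r ^ k) * r ^ k := mul_le_mul_of_nonneg_right h (hrk0 k).le
    have e : Z k ^ 2 * (L / r ^ k) * r ^ k = Z k ^ 2 * L := by
      field_simp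
    linarith [h', e.le, e.ge]
  -- hence `q^k ≤ B` for `q = r / E²`, `B = Z 0² · L / (c ν³)`
  set q : ℝ := r / E ^ 2 with hqdef
  set B : ℝ := Z 0 ^ 2 * L / (c * ν ^ 3) with hBdef
  have hcν : 0 < c * ν ^ 3 := mul_pos hc (pow_pos hν 3)
  have hqk : ∀ k : ℕ, q ^ k ≤ B := by
    intro k
    have h1 : Z k ^ 2 ≤ (Z 0 * E ^ k) ^ 2 := pow_le_pow_left₀ (hZ0 k) (hchain k) 2
    have h2 : c * ν ^ 3 * r ^ k / L ≤ Z 0 ^ 2 * (E ^ 2) ^ k := by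
      calc c * ν ^ 3 * r ^ k / L ≤ Z k ^ 2 := hleray k
        _ ≤ (Z 0 * E ^ k) ^ 2 := h1
        _ = Z 0 ^ 2 * (E ^ 2) ^ k := by ring
    have hEk : 0 < (E ^ 2) ^ k := pow_pos (pow_pos hE0 2) k
    rw [hqdef, div_pow, div_le_iff₀ hEk, hBdef]
    rw [div_le_iff₀ hL0] at h2
    rw [div_mul_eq_mul_div, le_div_iff₀ hcν]
    nlinarith [h2]
  -- but `q > 1`: `log r ≥ 1 − 1/r = δ/(1+δ) > 4εδ`
  have hq1 : 1 < q := by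
    rw [hqdef, lt_div_iff₀ (pow_pos hE0 2), one_mul, hEdef, ← Real.exp_nat_mul]
    have e4 : ((2 : ℕ) : ℝ) * (2 * ε * δ) = 4 * ε * δ := by push_cast; ring
    rw [e4, ← Real.lt_log_iff_exp_lt hr0]
    have hlog : 1 - r⁻¹ ≤ Real.log r := Real.one_sub_inv_le_log_of_pos hr0
    have hinv : 1 - r⁻¹ = δ / (1 + δ) := by
      rw [hrdef]; field_simp; ring
    have hkey : 4 * ε * δ < δ / (1 + δ) := by
      rw [lt_div_iff₀ (by linarith)]
      -- `4ε(1+δ) < 1` because `(1 − 2ε)(1 − 4ε) > 0`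
      have h14 : 4 * ε * (1 + δ) < 1 := by
        rw [hδdef]
        nlinarith [mul_pos (by linarith : (0 : ℝ) < 1 - 2 * ε) (by linarith : (0 : ℝ) < 1 - 4 * ε)]
      nlinarith [h14, hδ0]
    linarith [hlog, hinv.le, hinv.ge]
  -- contradiction: `q^k → ∞`
  obtain ⟨k, hk⟩ := ((tendsto_pow_atTop_atTop_of_one_lt hq1).eventually_gt_atTop B).exists
  exact absurd (hqk k) (not_le.2 hk)

/-- **L65, filter form**: along every maximal smooth Leray–Hopf solution of the unforced system (`ν > 0`), for every
`ε < 1/4`: `∃ᶠ t in 𝓝[<] T, ∃ x, ε < (T − t)·‖curl u(t, x)‖` — `limsup_{t↑T} (T − t)‖ω(t)‖_∞ ≥ 1/4`.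
[cite: RobinsonRodrigoSadowski2016, Thm 12.3 (12.12) and Lemma 6.11] -/
theorem ns_vorticity_typeI_frequently {ν T : ℝ} (hν : 0 < ν) (hT : 0 < T)
    {u : ℝ → EuclideanSpace ℝ (Fin 3) → EuclideanSpace ℝ (Fin 3)} {p : ℝ → EuclideanSpace ℝ (Fin 3) → ℝ}
    (hmax : IsMaximalSmoothSolution ν 0 u p T) (hLH : IsLerayHopfOn T ν 0 (u 0) u)
    {ε : ℝ} (hε : ε < 1 / 4) :
    ∃ᶠ t in 𝓝[<] T, ∃ x : EuclideanSpace ℝ (Fin 3), ε < (T - t) * ‖curl (u t) x‖ := by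
  rw [Filter.frequently_iff]
  intro U hU
  obtain ⟨l, hl, hlU⟩ := mem_nhdsLT_iff_exists_Ioo_subset.1 hU
  set a : ℝ := (max l 0 + T) / 2 with hadef
  have hm : max l 0 < T := max_lt hl hT
  have ha : a ∈ Ico 0 T := ⟨by rw [hadef]; linarith [le_max_right l 0], by rw [hadef]; linarith⟩
  have hla : l < a := by rw [hadef]; linarith [le_max_left l 0]
  obtain ⟨t, ht, x, hx⟩ := ns_vorticity_typeI_threshold hν hT hmax hLH hε ha
  exact ⟨t, hlU ⟨hla.trans_le ht.1, ht.2⟩, x, hx⟩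

/-! ## The interface reading -/

/-- **L65 READ ON THE INTERFACE: every cascade witness has `limsup_{t↑T} (T − t)‖ω(t)‖_∞ ≥ 1/4`.** Every
`W : CascadeWitness` yields `ν > 0`, `T > 0` and a maximal smooth solution `(u, p)` of the unforced Navier–Stokes system
on `ℝ³ × [0, T)`, Leray–Hopf from `u 0` (`x5a_of_cascadeWitness'`), such that for every `ε < 1/4` and every `a ∈ [0, T)`
some `t ∈ [a, T)` and `x` have `ε < (T − t)·‖curl u(t, x)‖`. [cite: RobinsonRodrigoSadowski2016, Thm 12.3 (12.12)] -/
theorem ns_vorticity_typeI_threshold_of_cascadeWitness (W : CascadeWitness) :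
    ∃ ν : ℝ, 0 < ν ∧ ∃ T : ℝ, 0 < T ∧
      ∃ (u : ℝ → EuclideanSpace ℝ (Fin 3) → EuclideanSpace ℝ (Fin 3)) (p : ℝ → EuclideanSpace ℝ (Fin 3) → ℝ),
        IsMaximalSmoothSolution ν 0 u p T ∧ IsLerayHopfOn T ν 0 (u 0) u ∧
        ∀ ε : ℝ, ε < 1 / 4 → ∀ a ∈ Ico 0 T,
          ∃ t ∈ Ico a T, ∃ x : EuclideanSpace ℝ (Fin 3), ε < (T - t) * ‖curl (u t) x‖ := by
  obtain ⟨ν, hν, T, hT, u, p, hmax, hLH, -⟩ := x5a_of_cascadeWitness' W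
  exact ⟨ν, hν, T, hT, u, p, hmax, hLH, fun _ hε _ ha => ns_vorticity_typeI_threshold hν hT hmax hLH hε ha⟩

end Summit.NavierStokesRegularity.FluidComputer.VorticityTypeIFace

end
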